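import Literature.NumberTheory.EllipticCurves.KummerSequenceConnecting
import Literature.NumberTheory.GaloisRepresentations.LocalTatePairing
import Literature.NumberTheory.GaloisRepresentations.ContinuousCupProductCompat
import Literature.NumberTheory.GaloisRepresentations.LocalKummerTorsion
import Literature.NumberTheory.GaloisRepresentations.CohomologicalDimension
import Literature.AnabelianGeometry.AbsoluteAnabelian.LocalResidueMapQmodZ
import HarnessLib

/-!
# The local Tate pairing along a change of module AND of level:
# `⟨ι_* a, b'⟩_{n'} = (μ_n ⊆ μ_{n'})_* ⟨a, ι^* b'⟩_n` for `ι : M → M'`, `n ∣ n'`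

Topic `NumberTheory/GaloisRepresentations`; namespace `Literature.NumberTheory.GaloisRepresentations`.
THEOREMS ONLY (no definition, no named fact, no `sorry`, no instance, no notation).

Let `K` be a number field, `v` a place, `M` and `M'` finite discrete `Γ_K`-modules killed by `n`,
resp. `n'`, with `n ∣ n'`, and `ι : M → M'` a `Γ_K`-equivariant map (e.g. a level inclusion
`𝐃[𝔪ᵏ] ⊆ 𝐃[𝔪ᵏ']` of a `Λ`-adic module).  The Tate duals `M^D = Hom(M, μ_n)` and
`(M')^D = Hom(M', μ_{n'})` are related by the "restriction" `ι^* : (M')^D → M^D`, `g ↦ g ∘ ι` — the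
values `g(ι m)` lying in `μ_{n'}[n] = μ_n` because `n · M = 0` — i.e. the `Γ_K`-equivariant map with
`(μ_n ⊆ μ_{n'}) ((ι^* g) m) = g (ι m)`.  Then for LOCAL classes `a ∈ H¹(K_v, M)`, `b' ∈ H¹(K_v, (M')^D)`
the local Tate pairings (cup products for the evaluation pairings, `localTatePairing`) at the two
levels satisfy

  `ι_* a ∪_{n'} b' = (μ_n ⊆ μ_{n'})_* (a ∪_n (ι^*)_* b')`   in `H²(K_v, μ_{n'})`

(`localTatePairing_map_eq_map_muIncl`; Neukirch–Schmidt–Wingberg (1.4.2), functoriality of the cup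
product: adjoint naturality `cupProduct_adjoint` twice through the auxiliary pairing
`M × (M')^D → μ_{n'}`, `(m, g) ↦ g(ι m)`, and covariant naturality `cupProduct_map` along
`μ_n ⊆ μ_{n'}` — all from `ContinuousCupProductCompat.lean`).  Composed with additive maps
`inv : H²(K_v, μ_n) → ℤ/n`, `inv' : H²(K_v, μ_{n'}) → ℤ/n'` satisfying the LEVEL-CHANGE LAW
`inv' ((μ_n ⊆ μ_{n'})_* z) = (n'/n) · inv z` (for THE invariant maps of local class field theory this
is Serre, *Corps locaux* XIII §3 Cor. 3 — in the tree `…PoitouTateReduction.canonical_map_muIncl`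
for `LocalInvariants.canonical`, every place), it gives the `ℤ/n'`-valued form
`⟨ι_* a, b'⟩_{n'} = (n'/n) · ⟨a, (ι^*)_* b'⟩_n` (`localTatePairingZMod_map_eq_of_levelChange`).
All maps are CONSUMED THROUGH THEIR POINTWISE VALUES (`ι`, `ι^*`, `μ_n ⊆ μ_{n'}` are arbitrary
continuous intertwining maps with the displayed values), so that any construction of the dual tower
instantiates them.

## Why (where this is used)

The Λ-adic Poitou–Tate arguments over a tower of finite levels `M_k = 𝐃[𝔪ᵏ]`, `T* = lim_k M_k^D`
(Greenberg, Kyoto J. Math. 50 (2010) §3.1: the pairing `P(K,D) × P(K,T*) → ℚ_p/ℤ_p` "defined by the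
local pairings (5)") need the finite-level local pairings to be COMPATIBLE along the tower; this is
that compatibility (road «SUR-Λ» of cell `bsd-eis`, brick C2b).  Nothing is asserted about any
arithmetic object; no case of local duality is proved here.

## References
* J. Neukirch, A. Schmidt, K. Wingberg, *Cohomology of Number Fields*, 2nd ed. (2008), I §4
  Prop. (1.4.2) (functoriality of the cup product). [NeukirchSchmidtWingberg2008]
* J. S. Milne, *Arithmetic Duality Theorems*, 2nd ed. (2006), Ch. I §0 (pairings), Cor. 2.3.
  [MilneADT2006]
* J.-P. Serre, *Corps locaux* (1968) / *Local Fields* (1979), XIII §3 Cor. 3 (invariants and level).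
  [SerreLocalFields1979]
* R. Greenberg, *Surjectivity of the global-to-local map defining a Selmer group*, Kyoto J. Math.
  50 (2010), §2 (5), §3.1 (9). [Greenberg2010]
-/

noncomputable section

open CategoryTheory Function NumberField IsDedekindDomain
open scoped NumberField ContRepresentation

universe u

namespace Literature.NumberTheory.GaloisRepresentations

open Field
open Literature.AnabelianGeometry.AbsoluteAnabelian.Prop121vii (zmodToQmodZ zmodToQmodZ_apply)
open _root_.TopRep _root_.ContRepresentation _root_.ContinuousCohomology
open DiscreteGaloisModule (mu MuCarrier TateDual tateDual tateDualEval tateDualEval_smul pairing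
  tateDualPairingLocal localTatePairing localTatePairingZMod homOfIntertwining)

section LevelChange

variable {K : Type u} [Field K] [NumberField K]
  {M : Type u} [AddCommGroup M] [TopologicalSpace M] [DiscreteTopology M] [Finite M]
  {M' : Type u} [AddCommGroup M'] [TopologicalSpace M'] [DiscreteTopology M'] [Finite M']
  (ρ : DiscreteGaloisModule K M) (ρ' : DiscreteGaloisModule K M') {n n' : ℕ}

/-- `Hⁿ(𝟙) = 𝟙` on continuous cohomology, applied (Mathlib `ContinuousCohomology.map_id`).
[cite: SerreGaloisCohomology1997, I §2.2] -/
private theorem cohomologyMap_id_apply' {k : Type*} [Ring k] [TopologicalSpace k]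
    {G : Type u} [Group G] [TopologicalSpace G] [IsTopologicalGroup G] (A : TopRep.{u} k G)
    (q : ℕ) (x : continuousCohomology q A) : cohomologyMap (𝟙 A) q x = x := by
  rw [show cohomologyMap (𝟙 A) q = 𝟙 _ from
    continuousCohomology_map_eq_id (ContinuousMonoidHom.id G) (resIdHom (𝟙 A)) rfl (fun _ => rfl) q]
  rfl

/-- **`ι_* a ∪_{n'} b' = (μ_n ⊆ μ_{n'})_* (a ∪_n (ι^*)_* b')` in `H²(K_v, μ_{n'})`** for local classes
`a ∈ H¹(K_v, M)`, `b' ∈ H¹(K_v, Hom(M', μ_{n'}))`, a `Γ_K`-equivariant `ι : M → M'`, `n ∣ n'`, and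
the dual transition `ι^* : Hom(M', μ_{n'}) → Hom(M, μ_n)` characterised by
`(μ_n ⊆ μ_{n'}) ((ι^* g) m) = g (ι m)` (functoriality of the cup product: adjoint naturality for
`(ι, 𝟙)` and `(𝟙, ι^*)` through the pairing `(m, g) ↦ g (ι m)`, covariant naturality along
`μ_n ⊆ μ_{n'}`). [cite: NeukirchSchmidtWingberg2008, I §4 Prop. (1.4.2)] [cite: MilneADT2006, Ch. I, Cor. 2.3] -/
theorem localTatePairing_map_eq_map_muIncl (hnn' : n ∣ n')
    (ι : ρ.toContRepresentation →ⁱL ρ'.toContRepresentation)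
    (red : (ρ'.tateDual n').toContRepresentation →ⁱL (ρ.tateDual n).toContRepresentation)
    (hred : ∀ (g : TateDual K M' n') (m : M), muInclusion K hnn' (red g m) = g (ι m))
    (j : (mu K n).toContRepresentation →ⁱL (mu K n').toContRepresentation)
    (hj : ∀ ζ : MuCarrier K n, j ζ = muInclusion K hnn' ζ) (v : Place K)
    (a : galoisCohomology (ρ.toLocal v) 1) (b' : galoisCohomology ((ρ'.tateDual n').toLocal v) 1) :
    localTatePairing ρ' n' v (galoisCohomology.map (ι.restrictField (Place.Completion v)) 1 a) b' =
      galoisCohomology.map (j.restrictField (Place.Completion v)) 2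
        (localTatePairing ρ n v a
          (galoisCohomology.map (red.restrictField (Place.Completion v)) 1 b')) := by
  haveI : CompactSpace (absoluteGaloisGroup (Place.Completion (K := K) v)) :=
    absoluteGaloisGroup_compactSpace _
  set E := Place.Completion (K := K) v with hE
  set P := tateDualPairingLocal ρ n v with hP
  set P' := tateDualPairingLocal ρ' n' v with hP'
  set ιE := homOfIntertwining (ι.restrictField E) with hιE
  set redE := homOfIntertwining (red.restrictField E) with hredE
  set jE := homOfIntertwining (j.restrictField E) with hjE
  -- the auxiliary pairing `P₃ : M × Hom(M', μ_{n'}) → μ_{n'}`, `(m, g) ↦ g (ι m)`, at `v`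
  let P₃ : ContPairing (ρ.toLocal v).toTopRep ((ρ'.tateDual n').toLocal v).toTopRep
      ((mu K n').toLocal v).toTopRep :=
    pairing (ρ.toLocal v) ((ρ'.tateDual n').toLocal v) ((mu K n').toLocal v)
      ((tateDualEval K M' n').comp ι.toContinuousLinearMap.toLinearMap.toAddMonoidHom)
      fun σ m g => by
        have hιm : ∀ τ : absoluteGaloisGroup K, ι (ρ τ m) = ρ' τ (ι m) := fun τ =>
          congrArg (fun T : M →L[ℤ] M' => T m) (ι.isIntertwining' τ)
        change tateDualEval K M' n' (ι (ρ _ m)) (ρ'.tateDual n' _ g) = mu K n' _ (tateDualEval K M' n' (ι m) g)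
        rw [hιm]
        exact tateDualEval_smul ρ' n' _ (ι m) g
  -- the auxiliary pairing `P₁' : M × Hom(M, μ_n) → μ_{n'}`, `(m, f) ↦ (μ_n ⊆ μ_{n'}) (f m)`, at `v`
  let P₁' : ContPairing (ρ.toLocal v).toTopRep ((ρ.tateDual n).toLocal v).toTopRep
      ((mu K n').toLocal v).toTopRep :=
    pairing (ρ.toLocal v) ((ρ.tateDual n).toLocal v) ((mu K n').toLocal v)
      ((tateDualEval K M n).compr₂ (muInclusion K hnn'))
      fun σ m f => by
        change muInclusion K hnn' (tateDualEval K M n (ρ _ m) (ρ.tateDual n _ f)) =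
          mu K n' _ (muInclusion K hnn' (tateDualEval K M n m f))
        rw [tateDualEval_smul ρ n _ m f]
        exact TopRep.hom_comm_apply (muInclHom K hnn') _ _
  -- step 1: `ι_* a ∪' b' = a ∪₃ b'`
  have h1 : P'.cupProduct (cohomologyMap ιE 1 a) b' = P₃.cupProduct a b' := by
    have h := ContPairing.cupProduct_adjoint (P₁ := P₃) (P₂ := P') ιE (𝟙 _) (fun _ _ => rfl) a b'
    rwa [cohomologyMap_id_apply'] at h
  -- step 2: `a ∪₃ b' = a ∪₁' (ι^*)_* b'`
  have h2 : P₃.cupProduct a b' = P₁'.cupProduct a (cohomologyMap redE 1 b') := by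
    have h := ContPairing.cupProduct_adjoint (P₁ := P₁') (P₂ := P₃) (𝟙 _) redE
      (fun m g => (hred g m).symm) a b'
    rwa [cohomologyMap_id_apply'] at h
  -- step 3: `(μ_n ⊆ μ_{n'})_* (a ∪ c) = a ∪₁' c`
  have h3 : cohomologyMap jE 2 (P.cupProduct a (cohomologyMap redE 1 b')) =
      P₁'.cupProduct a (cohomologyMap redE 1 b') := by
    have h := ContPairing.cupProduct_map (P₁ := P) (P₂ := P₁') (𝟙 _) (𝟙 _) jE
      (fun m f => hj (f m)) a (cohomologyMap redE 1 b')
    rwa [cohomologyMap_id_apply', cohomologyMap_id_apply'] at h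
  change P'.cupProduct (cohomologyMap ιE 1 a) b' =
    cohomologyMap jE 2 (P.cupProduct a (cohomologyMap redE 1 b'))
  rw [h1, h2, h3]

/-- **The `ℤ/n'`-valued form: `⟨ι_* a, b'⟩_{n'} = (n'/n) · ⟨a, (ι^*)_* b'⟩_n`** for additive maps
`inv`, `inv'` out of `H²(K_v, μ_n)`, `H²(K_v, μ_{n'})` obeying the level-change law
`inv' ((μ_n ⊆ μ_{n'})_* z) = (n'/n) · inv z` (e.g. THE invariant maps of local class field theory,
`LocalInvariants.canonical`, at every place). [cite: NeukirchSchmidtWingberg2008, I §4 Prop. (1.4.2)]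
[cite: SerreLocalFields1979, XIII §3 Cor. 3] [cite: MilneADT2006, Ch. I, Cor. 2.3] -/
theorem localTatePairingZMod_map_eq_of_levelChange (hnn' : n ∣ n')
    (ι : ρ.toContRepresentation →ⁱL ρ'.toContRepresentation)
    (red : (ρ'.tateDual n').toContRepresentation →ⁱL (ρ.tateDual n).toContRepresentation)
    (hred : ∀ (g : TateDual K M' n') (m : M), muInclusion K hnn' (red g m) = g (ι m))
    (j : (mu K n).toContRepresentation →ⁱL (mu K n').toContRepresentation)
    (hj : ∀ ζ : MuCarrier K n, j ζ = muInclusion K hnn' ζ) (v : Place K)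
    (inv : galoisCohomology ((mu K n).toLocal v) 2 →+ ZMod n)
    (inv' : galoisCohomology ((mu K n').toLocal v) 2 →+ ZMod n')
    (hinv : ∀ z : galoisCohomology ((mu K n).toLocal v) 2,
      inv' (galoisCohomology.map (j.restrictField (Place.Completion v)) 2 z) =
        (((inv z).val * (n' / n) : ℕ) : ZMod n'))
    (a : galoisCohomology (ρ.toLocal v) 1) (b' : galoisCohomology ((ρ'.tateDual n').toLocal v) 1) :
    localTatePairingZMod ρ' n' v inv' (galoisCohomology.map (ι.restrictField (Place.Completion v)) 1 a) b' =
      (((localTatePairingZMod ρ n v inv a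
          (galoisCohomology.map (red.restrictField (Place.Completion v)) 1 b')).val * (n' / n) : ℕ) :
        ZMod n') := by
  rw [DiscreteGaloisModule.localTatePairingZMod_apply, DiscreteGaloisModule.localTatePairingZMod_apply,
    localTatePairing_map_eq_map_muIncl ρ ρ' hnn' ι red hred j hj v a b', hinv]

/-- The level-change cast read in `ℚ/ℤ`: `((x·(n'/n)) mod n') / n' = x / n` for `x ∈ ℤ/n`, `n ∣ n'`.
[cite: SerreLocalFields1979, XIII §3 Cor. 3] -/
theorem zmodToQmodZ_natCast_val_mul_div [NeZero n] [NeZero n'] (hnn' : n ∣ n') (x : ZMod n) :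
    zmodToQmodZ n' (((x.val * (n' / n) : ℕ) : ZMod n')) = zmodToQmodZ n x := by
  obtain ⟨d, hd⟩ := hnn'
  have hn : 0 < n := Nat.pos_of_ne_zero (NeZero.ne n)
  have hd0 : 0 < d := Nat.pos_of_ne_zero fun h => NeZero.ne n' (by rw [hd, h, mul_zero])
  have hdn : n' / n = d := by rw [hd, Nat.mul_div_cancel_left d hn]
  have hlt : x.val * d < n' := by
    rw [hd]
    exact Nat.mul_lt_mul_of_lt_of_le (ZMod.val_lt x) le_rfl hd0
  rw [zmodToQmodZ_apply, zmodToQmodZ_apply, hdn, ZMod.val_natCast, Nat.mod_eq_of_lt hlt]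
  congr 1
  have hnQ : (n : ℚ) ≠ 0 := Nat.cast_ne_zero.2 (NeZero.ne n)
  have hdQ : (d : ℚ) ≠ 0 := Nat.cast_ne_zero.2 hd0.ne'
  rw [hd]
  push_cast
  field_simp

/-- **The `ℚ/ℤ`-valued form: `⟨ι_* a, b'⟩_{n'} / n' = ⟨a, (ι^*)_* b'⟩_n / n` in `ℚ/ℤ`** (the pairings
of the tower read in `ℚ/ℤ` are COMPATIBLE), for `inv`, `inv'` obeying the level-change law.
[cite: NeukirchSchmidtWingberg2008, I §4 Prop. (1.4.2)] [cite: SerreLocalFields1979, XIII §3 Cor. 3]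
[cite: Greenberg2010, §3.1 (9)] -/
theorem zmodToQmodZ_localTatePairingZMod_map_eq_of_levelChange [NeZero n] [NeZero n'] (hnn' : n ∣ n')
    (ι : ρ.toContRepresentation →ⁱL ρ'.toContRepresentation)
    (red : (ρ'.tateDual n').toContRepresentation →ⁱL (ρ.tateDual n).toContRepresentation)
    (hred : ∀ (g : TateDual K M' n') (m : M), muInclusion K hnn' (red g m) = g (ι m))
    (j : (mu K n).toContRepresentation →ⁱL (mu K n').toContRepresentation)
    (hj : ∀ ζ : MuCarrier K n, j ζ = muInclusion K hnn' ζ) (v : Place K)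
    (inv : galoisCohomology ((mu K n).toLocal v) 2 →+ ZMod n)
    (inv' : galoisCohomology ((mu K n').toLocal v) 2 →+ ZMod n')
    (hinv : ∀ z : galoisCohomology ((mu K n).toLocal v) 2,
      inv' (galoisCohomology.map (j.restrictField (Place.Completion v)) 2 z) =
        (((inv z).val * (n' / n) : ℕ) : ZMod n'))
    (a : galoisCohomology (ρ.toLocal v) 1) (b' : galoisCohomology ((ρ'.tateDual n').toLocal v) 1) :
    zmodToQmodZ n' (localTatePairingZMod ρ' n' v inv'
        (galoisCohomology.map (ι.restrictField (Place.Completion v)) 1 a) b') =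
      zmodToQmodZ n (localTatePairingZMod ρ n v inv a
        (galoisCohomology.map (red.restrictField (Place.Completion v)) 1 b')) := by
  rw [localTatePairingZMod_map_eq_of_levelChange ρ ρ' hnn' ι red hred j hj v inv inv' hinv a b',
    zmodToQmodZ_natCast_val_mul_div hnn']

end LevelChange

end Literature.NumberTheory.GaloisRepresentations

end
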